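import Summits.MatrixMultiplication.MatrixMultiplication.Theorems.SaturationLadderTwinExact
import Literature.Computability.AlgebraicComplexity.CertifiedEntropyNumerics
import HarnessLib

/-!
# SaturationLadder — a cancellation-free kernel certificate for the twin entropy inequalities

Support for the crux `SubexpSaturation` (h₁) of `Theses/SaturationLadder.lean` (lens «grading /
quantitative ladder», Kernel XXVI: the first VISIBLE uniform rung; this file is route-independent).
The exact twin theorem `omegaRect_one_tw_exact` (`Theorems/SaturationLadderTwinExact.lean`) turns an
output-perfect type `(n₁,…,n₆)` of the Coppersmith–Winograd twin tensor `TW_q`, `q = 2^j`, into the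
exact value `ω(1, t, r) = 1 + r` at a rational point, PROVIDED two Shannon-entropy inequalities
`∑ v log v ≤ ∑ z log z` between 3-term marginal sums hold (its hypotheses `hX`, `hY`).  So far
these were certified by hand (`Theorems/SaturationLadderTwinExactInstances.lean`, `j = 5, 8`) or
through absolute entropy enclosures (`EntropyCert.shannonEntropy_le/ge_of_check`), whose
`4·10⁻¹³`-wide `log` intervals cannot resolve the gap `≈ 2^{-j}` once `j ≳ 30`.

## §1  Removing the dominant weight analytically
Write each side as `p log p + q log q + u log u` with `p + q + u = D` and `p` the DOMINANT weight
(`p/D → 1` along the twin family).  The second-order two-sided Taylor bound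
(`twoNsq_mul_log_bounds`, from `Real.abs_log_sub_add_sum_range_le`)
`2Dm(D−m) + m(D−m)² − 2(D−m)³ ≤ 2D²·m(log D − log m) ≤ 2Dm(D−m) + m(D−m)² + 2(D−m)³`
replaces `p log p` and `w log w` by polynomials in the small co-weights `D − p`, `D − w` up to an
error `2(D−m)³`, with NO cancellation between numbers of size `D log D` (`wlogw_le_of_lower`).

## §2  The certificate
What is left — `2D²[(q+u) − (v+z)] log D + 2D²(q log q + u log u − v log v − z log z) ≥ −K` with the
explicit integer `K` of `wlogw₃_le_of_cert` — involves only `log D` and logarithms of the SMALL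
weights, with integer coefficients `≤ 2D³`; it is checked by the kernel evaluator
`EntropyCert.logFormLower` (absolute error `≈ 2D³·4·10⁻¹³` against a true slack of order `D³/j²`), so
`decide +kernel` succeeds in a fraction of a second for every twin we use (`D ≈ 2^{62}` at `j = 54`;
the evaluator needs `D < 2^{256}`).  `hX_of_cert` / `hY_of_cert` produce LITERALLY the two
hypotheses of `omegaRect_one_tw_exact` (dominant weights `n₂+n₄+n₆ ∣ n₂+n₃` resp. `n₁+n₂ ∣ n₂+n₃`),
and `omegaRect_one_tw_cert` is the certified exact-twin theorem: seven `norm_num`/`decide` side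
goals in, `ω(1, t, r) ≤ 1 + r` out.  The table of certified twins and the uniform rung built on it
are in `Theorems/SaturationLadderTwinTable.lean` and the next file.

References: D. Coppersmith, S. Winograd, J. Symbolic Comput. 9 (1990) §8 (key
`CoppersmithWinograd1990`); J. Alman, R. Duan, V. Vassilevska Williams, Y. Xu, Z. Xu, R. Zhou, SODA
2025, §3.4 (key `AlmanDuanVassilevskaWilliamsXuXuZhou2025`).
-/

set_option linter.dupNamespace false
-- (single-conjunct summit: the namespace repeats `MatrixMultiplication`)

noncomputable section

namespace Summit.MatrixMultiplication.MatrixMultiplication.Theorems.SaturationLadderTwinStableCert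

open Literature.Computability.AlgebraicComplexity
open Literature.Computability.AlgebraicComplexity.EntropyCert
open Summit.MatrixMultiplication.MatrixMultiplication.Theorems.SaturationLadderTwinExact
  (omegaRect_one_tw_exact)

/-! ## §1 Second-order two-sided bound for `m (log N − log m)` -/

/-- For `0 < m ≤ N`:
`2Nm(N−m) + m(N−m)² − 2(N−m)³ ≤ 2N² · m (log N − log m) ≤ 2Nm(N−m) + m(N−m)² + 2(N−m)³`
(Taylor expansion of `−log(1 − x)` at `x = (N − m)/N` to second order with the Mathlib remainder
`|x|³/(1 − |x|)`). [folklore] -/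
theorem twoNsq_mul_log_bounds {N m : ℝ} (hm : 0 < m) (hmN : m ≤ N) :
    2 * N * m * (N - m) + m * (N - m) ^ 2 - 2 * (N - m) ^ 3 ≤
        2 * N ^ 2 * (m * (Real.log N - Real.log m)) ∧
      2 * N ^ 2 * (m * (Real.log N - Real.log m)) ≤
        2 * N * m * (N - m) + m * (N - m) ^ 2 + 2 * (N - m) ^ 3 := by
  have hN : 0 < N := lt_of_lt_of_le hm hmN
  obtain ⟨x, hx⟩ : ∃ x : ℝ, x = (N - m) / N := ⟨_, rfl⟩
  have hx0 : 0 ≤ x := by rw [hx]; exact div_nonneg (by linarith) hN.le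
  have hx1 : x < 1 := by rw [hx, div_lt_one hN]; linarith
  have habs : |x| < 1 := by rwa [abs_of_nonneg hx0]
  have h := Real.abs_log_sub_add_sum_range_le habs 2
  rw [abs_of_nonneg hx0] at h
  have hsum : (∑ i ∈ Finset.range 2, x ^ (i + 1) / ((i : ℝ) + 1)) = x + x ^ 2 / 2 := by
    rw [Finset.sum_range_succ, Finset.sum_range_succ, Finset.sum_range_zero]
    push_cast
    ring
  rw [hsum] at h
  have h1x : 1 - x = m / N := by rw [hx]; field_simp; ring
  have hlog : Real.log (1 - x) = Real.log m - Real.log N := by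
    rw [h1x, Real.log_div hm.ne' hN.ne']
  rw [hlog, h1x] at h
  obtain ⟨hlo, hhi⟩ := abs_le.mp h
  have ex1 : 2 * N ^ 2 * m * x = 2 * N * m * (N - m) := by rw [hx]; field_simp
  have ex2 : 2 * N ^ 2 * m * (x ^ 2 / 2) = m * (N - m) ^ 2 := by rw [hx]; field_simp
  have ex3 : 2 * N ^ 2 * m * (x ^ 3 / (m / N)) = 2 * (N - m) ^ 3 := by
    rw [hx]; field_simp
  have hm2 : 0 ≤ 2 * N ^ 2 * m := by positivity
  have hhi' := mul_le_mul_of_nonneg_left hhi hm2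
  have hlo' := mul_le_mul_of_nonneg_left hlo hm2
  constructor
  · linarith [hhi', ex1, ex2, ex3]
  · linarith [hlo', ex1, ex2, ex3]

/-- Difference form: for `0 < m₁, m₂ ≤ N`,
`[2Nm₁(N−m₁) + m₁(N−m₁)² − 2(N−m₁)³] − [2Nm₂(N−m₂) + m₂(N−m₂)² + 2(N−m₂)³]
  ≤ 2N² (m₁ (log N − log m₁) − m₂ (log N − log m₂))`. [folklore] -/
theorem twoNsq_mul_log_diff {N m₁ m₂ : ℝ} (h₁ : 0 < m₁) (h₁N : m₁ ≤ N) (h₂ : 0 < m₂)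
    (h₂N : m₂ ≤ N) :
    (2 * N * m₁ * (N - m₁) + m₁ * (N - m₁) ^ 2 - 2 * (N - m₁) ^ 3) -
        (2 * N * m₂ * (N - m₂) + m₂ * (N - m₂) ^ 2 + 2 * (N - m₂) ^ 3) ≤
      2 * N ^ 2 * (m₁ * (Real.log N - Real.log m₁) - m₂ * (Real.log N - Real.log m₂)) := by
  have a := (twoNsq_mul_log_bounds h₁ h₁N).1
  have b := (twoNsq_mul_log_bounds h₂ h₂N).2
  linarith

/-- **Core deduction.** With `N = m₁ + s₁ = m₂ + s₂` (`mᵢ` the large weight, `sᵢ` the sum of the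
two small weights, `Sᵢ` the sum of `w log w` over the small weights): a lower bound
`−K ≤ 2N²(s₁ − s₂) log N − 2N² S₁ + 2N² S₂` with
`K = [2Nm₁s₁ + m₁s₁² − 2s₁³] − [2Nm₂s₂ + m₂s₂² + 2s₂³]` gives
`m₁ log m₁ + S₁ ≤ m₂ log m₂ + S₂`. [folklore] -/
theorem wlogw_le_of_lower {N m₁ m₂ s₁ s₂ S₁ S₂ : ℝ} (h₁ : 0 < m₁) (h₂ : 0 < m₂) (hs₁ : 0 ≤ s₁)
    (hs₂ : 0 ≤ s₂) (hN₁ : m₁ + s₁ = N) (hN₂ : m₂ + s₂ = N)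
    (hF : -((2 * N * m₁ * s₁ + m₁ * s₁ ^ 2 - 2 * s₁ ^ 3) -
        (2 * N * m₂ * s₂ + m₂ * s₂ ^ 2 + 2 * s₂ ^ 3)) ≤
      2 * N ^ 2 * (s₁ - s₂) * Real.log N - 2 * N ^ 2 * S₁ + 2 * N ^ 2 * S₂) :
    m₁ * Real.log m₁ + S₁ ≤ m₂ * Real.log m₂ + S₂ := by
  have h₁N : m₁ ≤ N := by linarith
  have h₂N : m₂ ≤ N := by linarith
  have hN : 0 < N := by linarith
  have hT := twoNsq_mul_log_diff h₁ h₁N h₂ h₂N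
  have e₁ : N - m₁ = s₁ := by linarith
  have e₂ : N - m₂ = s₂ := by linarith
  rw [e₁, e₂] at hT
  have key : 0 ≤ 2 * N ^ 2 * (m₂ * Real.log m₂ + S₂ - (m₁ * Real.log m₁ + S₁)) := by
    have es : s₁ - s₂ = m₂ - m₁ := by linarith
    rw [es] at hF
    linarith [hT, hF]
  have h2N : 0 < 2 * N ^ 2 := by positivity
  have := (mul_nonneg_iff_of_pos_left h2N).mp key
  linarith


/-! ## §2 The cancellation-free certificate for `∑ v log v ≤ ∑ z log z` -/

/-- **Generic certificate.**  Two triples of natural weights with the same total `D`: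
`(p, q, u)` with LARGE weight `p > 0` and `(v, w, z)` with LARGE weight `w > 0`.  If the kernel
check of the linear form in logarithms
`F = (2D²((q+u) − (v+z)), D) ∷ (−2D² q, q) ∷ (−2D² u, u) ∷ (2D² v, v) ∷ (2D² z, z)`
(zero weights contribute the neutral entry `(0, 1)`) certifies `2⁸⁰ · (−K) ≤ logFormLower F` with
`K = [2Dp(q+u) + p(q+u)² − 2(q+u)³] − [2Dw(v+z) + w(v+z)² + 2(v+z)³]`, then
`p log p + q log q + u log u ≤ v log v + w log w + z log z`.  Only the SMALL weights and `D` enter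
the form, with coefficients `O(D² · small)`: the enclosure error is `≈ 4·10⁻¹³ · 2D² · (small sum)`
against a gap of order `2D² · O(1)`, uniformly in the size of `D` (`< 2²⁵⁶`). [folklore] -/
theorem wlogw₃_le_of_cert (p q u v w z D : ℕ) (hp : 0 < p) (hw : 0 < w) (h₁ : p + q + u = D)
    (h₂ : v + w + z = D)
    (hc : logFormBad
          ((2 * (D : ℤ) ^ 2 * (((q + u : ℕ) : ℤ) - ((v + z : ℕ) : ℤ)), D) ::ₘ
            (weightEntries ![q, u] (2 * (D : ℤ) ^ 2) +
              weightEntries ![v, z] (-(2 * (D : ℤ) ^ 2)))) = 0 ∧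
        2 ^ 80 * -(((2 * D * p * (q + u) + p * (q + u) ^ 2 : ℕ) : ℤ) - ((2 * (q + u) ^ 3 : ℕ) : ℤ) -
            ((2 * D * w * (v + z) + w * (v + z) ^ 2 + 2 * (v + z) ^ 3 : ℕ) : ℤ)) ≤
          logFormLower
            ((2 * (D : ℤ) ^ 2 * (((q + u : ℕ) : ℤ) - ((v + z : ℕ) : ℤ)), D) ::ₘ
              (weightEntries ![q, u] (2 * (D : ℤ) ^ 2) +
                weightEntries ![v, z] (-(2 * (D : ℤ) ^ 2))))) :
    (p : ℝ) * Real.log p + (q : ℝ) * Real.log q + (u : ℝ) * Real.log u ≤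
      (v : ℝ) * Real.log v + (w : ℝ) * Real.log w + (z : ℝ) * Real.log z := by
  obtain ⟨hbad, hlow⟩ := hc
  have hval := logFormLower_le hbad
  have h0 := (Int.cast_le.mpr hlow).trans hval
  rw [Int.cast_mul, Int.cast_pow, Int.cast_ofNat] at h0
  have h1 := le_of_mul_le_mul_left h0 (by positivity)
  rw [logFormVal_cons, logFormVal_add, logFormVal_weightEntries, logFormVal_weightEntries] at h1
  simp only [Fin.sum_univ_two, Matrix.cons_val_zero, Matrix.cons_val_one] at h1
  push_cast at h1
  have hpR : (0 : ℝ) < p := by exact_mod_cast hp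
  have hwR : (0 : ℝ) < w := by exact_mod_cast hw
  have h₁R : (p : ℝ) + q + u = D := by exact_mod_cast h₁
  have h₂R : (v : ℝ) + w + z = D := by exact_mod_cast h₂
  have hcore := wlogw_le_of_lower (N := (D : ℝ)) (m₁ := (p : ℝ)) (m₂ := (w : ℝ))
    (s₁ := (q : ℝ) + u) (s₂ := (v : ℝ) + z)
    (S₁ := (q : ℝ) * Real.log q + (u : ℝ) * Real.log u)
    (S₂ := (v : ℝ) * Real.log v + (z : ℝ) * Real.log z) hpR hwR (by positivity) (by positivity)
    (by linarith) (by linarith) (by linarith)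
  linarith

/-- **Kernel certificate for the twin inequality `H(Z) ≤ H(X)`** of `omegaRect_one_tw_exact`
(`Theorems/SaturationLadderTwinExact.lean`) at a six-letter type `(n₁, …, n₆)` with `n₂ > 0`:
the conclusion is literally its hypothesis `hX`; the hypothesis is the generic certificate
`wlogw₃_le_of_cert` at `(p, q, u) = (n₂+n₄+n₆, n₁+n₃, n₅)` (the `X`-marginal, large weight first)
and `(v, w, z) = (n₁+n₄+n₅, n₂+n₃, n₆)` (the `Z`-marginal), `D = n₁ + ⋯ + n₆`, decided by
`decide +kernel` at numerals.  Unlike `EntropyCert.entropyLeCheck/entropyGeCheck` (absolute entropy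
values, precision `≈ 10⁻¹²` bits) it certifies the DIFFERENCE without cancellation, so it scales to
the twin types `TW_{2^j}` with `j` up to `≈ 120` (`D < 2²⁵⁶`). [folklore] -/
theorem hX_of_cert (n₁ n₂ n₃ n₄ n₅ n₆ : ℕ) (hn₂ : 0 < n₂)
    (hc : logFormBad
          ((2 * ((n₁ + n₂ + n₃ + n₄ + n₅ + n₆ : ℕ) : ℤ) ^ 2 *
                (((n₁ + n₃ + n₅ : ℕ) : ℤ) - ((n₁ + n₄ + n₅ + n₆ : ℕ) : ℤ)),
              n₁ + n₂ + n₃ + n₄ + n₅ + n₆) ::ₘ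
            (weightEntries ![n₁ + n₃, n₅] (2 * ((n₁ + n₂ + n₃ + n₄ + n₅ + n₆ : ℕ) : ℤ) ^ 2) +
              weightEntries ![n₁ + n₄ + n₅, n₆]
                (-(2 * ((n₁ + n₂ + n₃ + n₄ + n₅ + n₆ : ℕ) : ℤ) ^ 2)))) = 0 ∧
        2 ^ 80 * -(((2 * (n₁ + n₂ + n₃ + n₄ + n₅ + n₆) * (n₂ + n₄ + n₆) * (n₁ + n₃ + n₅) +
              (n₂ + n₄ + n₆) * (n₁ + n₃ + n₅) ^ 2 : ℕ) : ℤ) - ((2 * (n₁ + n₃ + n₅) ^ 3 : ℕ) : ℤ) -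
            ((2 * (n₁ + n₂ + n₃ + n₄ + n₅ + n₆) * (n₂ + n₃) * (n₁ + n₄ + n₅ + n₆) +
              (n₂ + n₃) * (n₁ + n₄ + n₅ + n₆) ^ 2 + 2 * (n₁ + n₄ + n₅ + n₆) ^ 3 : ℕ) : ℤ)) ≤
          logFormLower
            ((2 * ((n₁ + n₂ + n₃ + n₄ + n₅ + n₆ : ℕ) : ℤ) ^ 2 *
                  (((n₁ + n₃ + n₅ : ℕ) : ℤ) - ((n₁ + n₄ + n₅ + n₆ : ℕ) : ℤ)),
                n₁ + n₂ + n₃ + n₄ + n₅ + n₆) ::ₘ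
              (weightEntries ![n₁ + n₃, n₅] (2 * ((n₁ + n₂ + n₃ + n₄ + n₅ + n₆ : ℕ) : ℤ) ^ 2) +
                weightEntries ![n₁ + n₄ + n₅, n₆]
                  (-(2 * ((n₁ + n₂ + n₃ + n₄ + n₅ + n₆ : ℕ) : ℤ) ^ 2))))) :
    shannonEntropy ![((n₁ : ℝ) + n₄ + n₅) / (n₁ + n₂ + n₃ + n₄ + n₅ + n₆ : ℕ),
          ((n₂ : ℝ) + n₃) / (n₁ + n₂ + n₃ + n₄ + n₅ + n₆ : ℕ),
          (n₆ : ℝ) / (n₁ + n₂ + n₃ + n₄ + n₅ + n₆ : ℕ)] ≤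
        shannonEntropy ![((n₂ : ℝ) + n₄ + n₆) / (n₁ + n₂ + n₃ + n₄ + n₅ + n₆ : ℕ),
          ((n₁ : ℝ) + n₃) / (n₁ + n₂ + n₃ + n₄ + n₅ + n₆ : ℕ),
          (n₅ : ℝ) / (n₁ + n₂ + n₃ + n₄ + n₅ + n₆ : ℕ)] := by
  have hA := wlogw₃_le_of_cert (n₂ + n₄ + n₆) (n₁ + n₃) n₅ (n₁ + n₄ + n₅) (n₂ + n₃) n₆
    (n₁ + n₂ + n₃ + n₄ + n₅ + n₆) (by omega) (by omega) (by omega) (by omega) hc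
  have hD : 0 < n₁ + n₂ + n₃ + n₄ + n₅ + n₆ := by omega
  have hDR : (0 : ℝ) < (n₁ + n₂ + n₃ + n₄ + n₅ + n₆ : ℕ) := by exact_mod_cast hD
  have hZ := log_two_mul_shannonEntropy_natWeights ![n₁ + n₄ + n₅, n₂ + n₃, n₆]
    (W := n₁ + n₂ + n₃ + n₄ + n₅ + n₆) (by simp only [Fin.sum_univ_three, Matrix.cons_val_zero, Matrix.cons_val_one,
      Matrix.cons_val_two, Matrix.head_cons, Matrix.tail_cons]; omega) hD
  have hX := log_two_mul_shannonEntropy_natWeights ![n₂ + n₄ + n₆, n₁ + n₃, n₅]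
    (W := n₁ + n₂ + n₃ + n₄ + n₅ + n₆) (by simp only [Fin.sum_univ_three, Matrix.cons_val_zero, Matrix.cons_val_one,
      Matrix.cons_val_two, Matrix.head_cons, Matrix.tail_cons]; omega) hD
  have hsum : (∑ i, ((![n₂ + n₄ + n₆, n₁ + n₃, n₅] i : ℕ) : ℝ) *
        Real.log ((![n₂ + n₄ + n₆, n₁ + n₃, n₅] i : ℕ) : ℝ)) ≤
      ∑ i, ((![n₁ + n₄ + n₅, n₂ + n₃, n₆] i : ℕ) : ℝ) *
        Real.log ((![n₁ + n₄ + n₅, n₂ + n₃, n₆] i : ℕ) : ℝ) := by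
    simp only [Fin.sum_univ_three, Matrix.cons_val_zero, Matrix.cons_val_one, Matrix.cons_val_two,
      Matrix.head_cons, Matrix.tail_cons]
    push_cast at hA ⊢
    linarith
  have hl2 : 0 < Real.log 2 := Real.log_pos one_lt_two
  have hmain : shannonEntropy (fun i => ((![n₁ + n₄ + n₅, n₂ + n₃, n₆] i : ℕ) : ℝ) /
        (n₁ + n₂ + n₃ + n₄ + n₅ + n₆ : ℕ)) ≤
      shannonEntropy (fun i => ((![n₂ + n₄ + n₆, n₁ + n₃, n₅] i : ℕ) : ℝ) /
        (n₁ + n₂ + n₃ + n₄ + n₅ + n₆ : ℕ)) := by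
    refine le_of_mul_le_mul_left ?_ hl2
    rw [hZ, hX]
    have := div_le_div_of_nonneg_right hsum hDR.le
    linarith
  convert hmain using 2 <;> (funext i; fin_cases i <;> simp)

/-- **Kernel certificate for the twin inequality `H(Z) ≤ H(Y)`** of `omegaRect_one_tw_exact`:
`wlogw₃_le_of_cert` at `(p, q, u) = (n₁+n₂, n₃+n₅+n₆, n₄)` (the `Y`-marginal, large weight
first) and `(v, w, z) = (n₁+n₄+n₅, n₂+n₃, n₆)`. [folklore] -/
theorem hY_of_cert (n₁ n₂ n₃ n₄ n₅ n₆ : ℕ) (hn₂ : 0 < n₂)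
    (hc : logFormBad
          ((2 * ((n₁ + n₂ + n₃ + n₄ + n₅ + n₆ : ℕ) : ℤ) ^ 2 *
                (((n₃ + n₅ + n₆ + n₄ : ℕ) : ℤ) - ((n₁ + n₄ + n₅ + n₆ : ℕ) : ℤ)),
              n₁ + n₂ + n₃ + n₄ + n₅ + n₆) ::ₘ
            (weightEntries ![n₃ + n₅ + n₆, n₄] (2 * ((n₁ + n₂ + n₃ + n₄ + n₅ + n₆ : ℕ) : ℤ) ^ 2) +
              weightEntries ![n₁ + n₄ + n₅, n₆]
                (-(2 * ((n₁ + n₂ + n₃ + n₄ + n₅ + n₆ : ℕ) : ℤ) ^ 2)))) = 0 ∧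
        2 ^ 80 * -(((2 * (n₁ + n₂ + n₃ + n₄ + n₅ + n₆) * (n₁ + n₂) * (n₃ + n₅ + n₆ + n₄) +
              (n₁ + n₂) * (n₃ + n₅ + n₆ + n₄) ^ 2 : ℕ) : ℤ) - ((2 * (n₃ + n₅ + n₆ + n₄) ^ 3 : ℕ) : ℤ) -
            ((2 * (n₁ + n₂ + n₃ + n₄ + n₅ + n₆) * (n₂ + n₃) * (n₁ + n₄ + n₅ + n₆) +
              (n₂ + n₃) * (n₁ + n₄ + n₅ + n₆) ^ 2 + 2 * (n₁ + n₄ + n₅ + n₆) ^ 3 : ℕ) : ℤ)) ≤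
          logFormLower
            ((2 * ((n₁ + n₂ + n₃ + n₄ + n₅ + n₆ : ℕ) : ℤ) ^ 2 *
                  (((n₃ + n₅ + n₆ + n₄ : ℕ) : ℤ) - ((n₁ + n₄ + n₅ + n₆ : ℕ) : ℤ)),
                n₁ + n₂ + n₃ + n₄ + n₅ + n₆) ::ₘ
              (weightEntries ![n₃ + n₅ + n₆, n₄] (2 * ((n₁ + n₂ + n₃ + n₄ + n₅ + n₆ : ℕ) : ℤ) ^ 2) +
                weightEntries ![n₁ + n₄ + n₅, n₆]
                  (-(2 * ((n₁ + n₂ + n₃ + n₄ + n₅ + n₆ : ℕ) : ℤ) ^ 2))))) :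
    shannonEntropy ![((n₁ : ℝ) + n₄ + n₅) / (n₁ + n₂ + n₃ + n₄ + n₅ + n₆ : ℕ),
          ((n₂ : ℝ) + n₃) / (n₁ + n₂ + n₃ + n₄ + n₅ + n₆ : ℕ),
          (n₆ : ℝ) / (n₁ + n₂ + n₃ + n₄ + n₅ + n₆ : ℕ)] ≤
        shannonEntropy ![((n₃ : ℝ) + n₅ + n₆) / (n₁ + n₂ + n₃ + n₄ + n₅ + n₆ : ℕ),
          ((n₁ : ℝ) + n₂) / (n₁ + n₂ + n₃ + n₄ + n₅ + n₆ : ℕ),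
          (n₄ : ℝ) / (n₁ + n₂ + n₃ + n₄ + n₅ + n₆ : ℕ)] := by
  have hA := wlogw₃_le_of_cert (n₁ + n₂) (n₃ + n₅ + n₆) n₄ (n₁ + n₄ + n₅) (n₂ + n₃) n₆
    (n₁ + n₂ + n₃ + n₄ + n₅ + n₆) (by omega) (by omega) (by omega) (by omega) hc
  have hD : 0 < n₁ + n₂ + n₃ + n₄ + n₅ + n₆ := by omega
  have hDR : (0 : ℝ) < (n₁ + n₂ + n₃ + n₄ + n₅ + n₆ : ℕ) := by exact_mod_cast hD
  have hZ := log_two_mul_shannonEntropy_natWeights ![n₁ + n₄ + n₅, n₂ + n₃, n₆]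
    (W := n₁ + n₂ + n₃ + n₄ + n₅ + n₆) (by simp only [Fin.sum_univ_three, Matrix.cons_val_zero, Matrix.cons_val_one,
      Matrix.cons_val_two, Matrix.head_cons, Matrix.tail_cons]; omega) hD
  have hY := log_two_mul_shannonEntropy_natWeights ![n₃ + n₅ + n₆, n₁ + n₂, n₄]
    (W := n₁ + n₂ + n₃ + n₄ + n₅ + n₆) (by simp only [Fin.sum_univ_three, Matrix.cons_val_zero, Matrix.cons_val_one,
      Matrix.cons_val_two, Matrix.head_cons, Matrix.tail_cons]; omega) hD
  have hsum : (∑ i, ((![n₃ + n₅ + n₆, n₁ + n₂, n₄] i : ℕ) : ℝ) *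
        Real.log ((![n₃ + n₅ + n₆, n₁ + n₂, n₄] i : ℕ) : ℝ)) ≤
      ∑ i, ((![n₁ + n₄ + n₅, n₂ + n₃, n₆] i : ℕ) : ℝ) *
        Real.log ((![n₁ + n₄ + n₅, n₂ + n₃, n₆] i : ℕ) : ℝ) := by
    simp only [Fin.sum_univ_three, Matrix.cons_val_zero, Matrix.cons_val_one, Matrix.cons_val_two,
      Matrix.head_cons, Matrix.tail_cons]
    push_cast at hA ⊢
    linarith
  have hl2 : 0 < Real.log 2 := Real.log_pos one_lt_two
  have hmain : shannonEntropy (fun i => ((![n₁ + n₄ + n₅, n₂ + n₃, n₆] i : ℕ) : ℝ) /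
        (n₁ + n₂ + n₃ + n₄ + n₅ + n₆ : ℕ)) ≤
      shannonEntropy (fun i => ((![n₃ + n₅ + n₆, n₁ + n₂, n₄] i : ℕ) : ℝ) /
        (n₁ + n₂ + n₃ + n₄ + n₅ + n₆ : ℕ)) := by
    refine le_of_mul_le_mul_left ?_ hl2
    rw [hZ, hY]
    have := div_le_div_of_nonneg_right hsum hDR.le
    linarith
  convert hmain using 2 <;> (funext i; fin_cases i <;> simp)

/-- **The certified exact twin point.**  `omegaRect_one_tw_exact` with both entropy hypotheses
replaced by their kernel certificates (`hX_of_cert`, `hY_of_cert`): for an output-perfect type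
`(n₁,…,n₆)` of `TW_{2^j}` (`n₁+n₄+n₅ = 2n₆`, `n₂+n₃ = 2^{j+1} n₆`, `n₂, n₆ > 0`) passing the two
checks, `ω(1, t, r) ≤ 1 + r` at `t = j n₁/((j+1)n₃+n₅)`, `r = ((j+1)n₂+n₁+n₄)/((j+1)n₃+n₅)`.
[cite: CoppersmithWinograd1990, §8] [cite: AlmanDuanVassilevskaWilliamsXuXuZhou2025, §3.4] -/
theorem omegaRect_one_tw_cert (j n₁ n₂ n₃ n₄ n₅ n₆ : ℕ) (hn₆ : 0 < n₆)
    (hz₁ : n₁ + n₄ + n₅ = 2 * n₆) (hz₂ : n₂ + n₃ = 2 ^ (j + 1) * n₆) (hz₀ : 0 < (j + 1) * n₃ + n₅)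
    (hn₂ : 0 < n₂)
    (hcX : logFormBad
          ((2 * ((n₁ + n₂ + n₃ + n₄ + n₅ + n₆ : ℕ) : ℤ) ^ 2 *
                (((n₁ + n₃ + n₅ : ℕ) : ℤ) - ((n₁ + n₄ + n₅ + n₆ : ℕ) : ℤ)),
              n₁ + n₂ + n₃ + n₄ + n₅ + n₆) ::ₘ
            (weightEntries ![n₁ + n₃, n₅] (2 * ((n₁ + n₂ + n₃ + n₄ + n₅ + n₆ : ℕ) : ℤ) ^ 2) +
              weightEntries ![n₁ + n₄ + n₅, n₆]
                (-(2 * ((n₁ + n₂ + n₃ + n₄ + n₅ + n₆ : ℕ) : ℤ) ^ 2)))) = 0 ∧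
        2 ^ 80 * -(((2 * (n₁ + n₂ + n₃ + n₄ + n₅ + n₆) * (n₂ + n₄ + n₆) * (n₁ + n₃ + n₅) +
              (n₂ + n₄ + n₆) * (n₁ + n₃ + n₅) ^ 2 : ℕ) : ℤ) - ((2 * (n₁ + n₃ + n₅) ^ 3 : ℕ) : ℤ) -
            ((2 * (n₁ + n₂ + n₃ + n₄ + n₅ + n₆) * (n₂ + n₃) * (n₁ + n₄ + n₅ + n₆) +
              (n₂ + n₃) * (n₁ + n₄ + n₅ + n₆) ^ 2 + 2 * (n₁ + n₄ + n₅ + n₆) ^ 3 : ℕ) : ℤ)) ≤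
          logFormLower
            ((2 * ((n₁ + n₂ + n₃ + n₄ + n₅ + n₆ : ℕ) : ℤ) ^ 2 *
                  (((n₁ + n₃ + n₅ : ℕ) : ℤ) - ((n₁ + n₄ + n₅ + n₆ : ℕ) : ℤ)),
                n₁ + n₂ + n₃ + n₄ + n₅ + n₆) ::ₘ
              (weightEntries ![n₁ + n₃, n₅] (2 * ((n₁ + n₂ + n₃ + n₄ + n₅ + n₆ : ℕ) : ℤ) ^ 2) +
                weightEntries ![n₁ + n₄ + n₅, n₆]
                  (-(2 * ((n₁ + n₂ + n₃ + n₄ + n₅ + n₆ : ℕ) : ℤ) ^ 2)))))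
    (hcY : logFormBad
          ((2 * ((n₁ + n₂ + n₃ + n₄ + n₅ + n₆ : ℕ) : ℤ) ^ 2 *
                (((n₃ + n₅ + n₆ + n₄ : ℕ) : ℤ) - ((n₁ + n₄ + n₅ + n₆ : ℕ) : ℤ)),
              n₁ + n₂ + n₃ + n₄ + n₅ + n₆) ::ₘ
            (weightEntries ![n₃ + n₅ + n₆, n₄] (2 * ((n₁ + n₂ + n₃ + n₄ + n₅ + n₆ : ℕ) : ℤ) ^ 2) +
              weightEntries ![n₁ + n₄ + n₅, n₆]
                (-(2 * ((n₁ + n₂ + n₃ + n₄ + n₅ + n₆ : ℕ) : ℤ) ^ 2)))) = 0 ∧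
        2 ^ 80 * -(((2 * (n₁ + n₂ + n₃ + n₄ + n₅ + n₆) * (n₁ + n₂) * (n₃ + n₅ + n₆ + n₄) +
              (n₁ + n₂) * (n₃ + n₅ + n₆ + n₄) ^ 2 : ℕ) : ℤ) - ((2 * (n₃ + n₅ + n₆ + n₄) ^ 3 : ℕ) : ℤ) -
            ((2 * (n₁ + n₂ + n₃ + n₄ + n₅ + n₆) * (n₂ + n₃) * (n₁ + n₄ + n₅ + n₆) +
              (n₂ + n₃) * (n₁ + n₄ + n₅ + n₆) ^ 2 + 2 * (n₁ + n₄ + n₅ + n₆) ^ 3 : ℕ) : ℤ)) ≤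
          logFormLower
            ((2 * ((n₁ + n₂ + n₃ + n₄ + n₅ + n₆ : ℕ) : ℤ) ^ 2 *
                  (((n₃ + n₅ + n₆ + n₄ : ℕ) : ℤ) - ((n₁ + n₄ + n₅ + n₆ : ℕ) : ℤ)),
                n₁ + n₂ + n₃ + n₄ + n₅ + n₆) ::ₘ
              (weightEntries ![n₃ + n₅ + n₆, n₄] (2 * ((n₁ + n₂ + n₃ + n₄ + n₅ + n₆ : ℕ) : ℤ) ^ 2) +
                weightEntries ![n₁ + n₄ + n₅, n₆]
                  (-(2 * ((n₁ + n₂ + n₃ + n₄ + n₅ + n₆ : ℕ) : ℤ) ^ 2))))) :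
    omegaRect ℂ 1 (((j : ℝ) * n₁) / (((j : ℝ) + 1) * n₃ + n₅))
        ((((j : ℝ) + 1) * n₂ + n₁ + n₄) / (((j : ℝ) + 1) * n₃ + n₅)) ≤
      1 + (((j : ℝ) + 1) * n₂ + n₁ + n₄) / (((j : ℝ) + 1) * n₃ + n₅) :=
  omegaRect_one_tw_exact j n₁ n₂ n₃ n₄ n₅ n₆ hn₆ hz₁ hz₂ hz₀ (hX_of_cert n₁ n₂ n₃ n₄ n₅ n₆ hn₂ hcX)
    (hY_of_cert n₁ n₂ n₃ n₄ n₅ n₆ hn₂ hcY)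

end Summit.MatrixMultiplication.MatrixMultiplication.Theorems.SaturationLadderTwinStableCert
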